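import Literature.NumberTheory.Automorphic.PAdicReps
import Literature.NumberTheory.Automorphic.ParabolicInduction
import Literature.NumberTheory.Automorphic.ParabolicGLProofs
import Literature.NumberTheory.Automorphic.PAdicRepsSupercuspidalProofs
import Literature.NumberTheory.Automorphic.MatrixCoefficientsSupercuspidalAdmissibleProofs
import HarnessLib

/-!
# Jacquet's admissibility theorem for `GL_n(F)` (lang.S16): reduction to the supercuspidal support

Sibling proof file of `Literature.NumberTheory.Automorphic.PAdicReps` (like `PAdicRepsProofs`,
`PAdicRepsSupercuspidalProofs`, `PAdicRepsQuaternionUnitsProofs`), towards the discharge of the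
named fact `Literature.NumberTheory.Automorphic.jacquetAdmissibility_gl F` (**lang.S16**;
Bernstein–Zelevinsky 1976, Theorem 3.25; Jacquet 1975): *every irreducible smooth complex
representation of `GL_n(F)`, `F` a non-archimedean local field, is admissible.*

## The printed proof and what this file proves

Bernstein–Zelevinsky prove 3.25 (and, in the 1977 paper, the last clause "in particular `ω` is
admissible" of Thm. 2.5) as follows: an irreducible smooth `π` embeds into a parabolically
induced representation `i_c σ` with `σ` an irreducible *cuspidal* representation of a standard
Levi `Π_a GL_{n_a}(F)` (the supercuspidal support, 1977 Thm. 2.5 (a) / 1976 §3.19–3.20); `σ` is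
admissible by Harish-Chandra's theorem (1976, 3.21: irreducible cuspidal representations have
matrix coefficients compactly supported modulo the centre and are admissible); induction
preserves admissibility (1976, 2.25 (c) / 1977 Prop. 2.3 (e)); and subrepresentations of
admissible representations are admissible.

Of these four steps the tree has, fully proved:
* induction preserves admissibility on `GL_n(F)`:
  `Representation.isAdmissible_parabolicIndGL_holds` (`ParabolicGLProofs`);
* irreducible smooth supercuspidal ⇒ admissible, for any `σ`-compact group:
  `Representation.IsSupercuspidal.isAdmissible_of_sigmaCompactSpace`
  (`MatrixCoefficientsSupercuspidalAdmissibleProofs`; Getz–Hahn 2024, Prop. 8.3.4), together with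
  the `σ`-compactness of `GL_n(F)` (`PAdicRepsSupercuspidalProofs`);
and records the first step as the named fact
`Literature.NumberTheory.Automorphic.bernsteinZelevinsky_support` (`ParabolicInduction`;
Bernstein–Zelevinsky 1977, Thm. 2.5), whose discharge is in progress in the sibling files
`ParabolicInduction*Proofs`.

This file proves, sorry-free and with no new definition or named fact (D-0026):
* `sigmaCompactSpace_generalLinearGroup'` — `GL_ι(F)` is `σ`-compact for ANY finite index type
  `ι` (the blocks `GL_{n_a}` of a Levi are indexed by subtypes of `Fin n`), hence so is the
  standard Levi `Π_a GL_{n_a}(F)`;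
* `Representation.IsAdmissible.of_injective` — a smooth representation embedding equivariantly
  into an admissible one is admissible (`V^K ↪ W^K`);
* `jacquetAdmissibility_gl_of_bernsteinZelevinsky_support` — **the reduction**
  `(∀ n V, bernsteinZelevinsky_support F) → jacquetAdmissibility_gl F`, i.e. steps 2–4 of the
  printed proof assembled; the discharge `jacquetAdmissibility_gl_holds` is then the one-liner
  `jacquetAdmissibility_gl_of_bernsteinZelevinsky_support (fun n V => bernsteinZelevinsky_support_holds …)`
  once the support theorem lands.

## Caveat (mis-statement of the vendored constant)

`jacquetAdmissibility_gl` was vendored under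
`variable [ValuativeRel F] [TopologicalSpace F] [IsNonarchimedeanLocalField F]`, but a `def`
absorbs only the section variables its body uses, so the constant only takes
`[Field F] [TopologicalSpace F]`: as a closed statement it speaks about every topological field and
is false (cf. the module docstring of `ParabolicInductionAdmissibleProofs`). The reduction below is
an implication at a FIXED non-archimedean local field `F`, where all instances are present, so it
elaborates against either the defective or the repaired (explicit binders) form of the constant;
the repair of `PAdicReps` accompanies this file.

## References

* I. N. Bernstein, A. V. Zelevinsky, *Representations of the group `GL(n, F)` where `F` is a
  non-archimedean local field*, Russian Math. Surveys 31:3 (1976), 1–68, Theorem 3.25 (with 3.21,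
  2.25) [BernsteinZelevinsky1976] (not held).
* I. N. Bernstein, A. V. Zelevinsky, *Induced representations of reductive `p`-adic groups I*,
  Ann. Sci. ÉNS (4) 10 (1977), 441–472, Thm. 2.5 and Prop. 2.3 (e) [BernsteinZelevinsky1977].
* H. Jacquet, *Sur les représentations des groupes réductifs p-adiques*, C. R. Acad. Sci. Paris
  Sér. A 280 (1975), 1271–1272 [Jacquet1975].
* J. R. Getz, H. Hahn, *An Introduction to Automorphic Representations*, GTM 300 (2024),
  Prop. 8.3.4 [GetzHahn2024].
-/

noncomputable section

open scoped MatrixGroups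

/-! ### Admissibility passes to embedded subrepresentations -/

namespace Representation

variable {k G V W : Type*} [Field k] [Group G] [TopologicalSpace G] [AddCommGroup V] [Module k V]
  [AddCommGroup W] [Module k W] {ρ : Representation k G V} {τ : Representation k G W}

/-- **A smooth representation which embeds equivariantly into an admissible representation is
admissible**: an injective intertwining map `f : ρ → τ` restricts to an injection `V^K ↪ W^K` of
`K`-fixed vectors, and `W^K` is finitely generated (subrepresentations of admissible
representations are admissible; Bernstein–Zelevinsky 1976, §2; Bushnell–Henniart 2006, §2.1).
Deliberate dot-notation extension of Mathlib's `Representation` namespace, next to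
`Representation.IsAdmissible`. [folklore] -/
theorem IsAdmissible.of_injective (hρ : ρ.IsSmooth) (f : ρ.IntertwiningMap τ)
    (hf : Function.Injective f) (hτ : τ.IsAdmissible) : ρ.IsAdmissible := by
  refine ⟨hρ, fun K hK => ?_⟩
  haveI : Module.Finite k (τ.fixedPoints (K : Subgroup G)) := hτ.2 K hK
  have hmap : ∀ v ∈ ρ.fixedPoints (K : Subgroup G), f.toLinearMap v ∈ τ.fixedPoints (K : Subgroup G) := by
    intro v hv
    rw [Representation.mem_fixedPoints] at hv ⊢
    intro g hg
    rw [Representation.IntertwiningMap.toLinearMap_apply,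
      ← Representation.IntertwiningMap.isIntertwining ρ τ f g v, hv g hg]
  refine Module.Finite.of_injective (f.toLinearMap.restrict hmap) fun x y hxy => ?_
  apply Subtype.ext
  apply hf
  have h := congrArg Subtype.val hxy
  simpa [LinearMap.restrict_apply] using h

end Representation

namespace Literature.NumberTheory.Automorphic

universe u

variable {F : Type u} [Field F] [ValuativeRel F] [TopologicalSpace F] [IsNonarchimedeanLocalField F]

/-! ### `σ`-compactness of `GL_ι(F)` and of the standard Levi -/

variable (F) in
/-- **`GL_ι(F)` is `σ`-compact** for a non-archimedean local field `F` and any finite index type `ι`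
(the proof of `sigmaCompactSpace_generalLinearGroup` of `PAdicRepsSupercuspidalProofs`, which is
stated for `ι = Fin n`, verbatim: `M_ι(F) = F^{ι × ι}` is `σ`-compact and the unit group is closed
in `M_ι(F) × M_ι(F)ᵐᵒᵖ`, Mathlib `Units.isClosedEmbedding_embedProduct`). (Weil 1967, Ch. I §4;
Bushnell–Henniart §1.1.) [folklore] -/
theorem sigmaCompactSpace_generalLinearGroup' (ι : Type*) [Fintype ι] [DecidableEq ι] :
    SigmaCompactSpace (GL ι F) := by
  haveI : T2Space F := (GaloisRepresentations.IsNonarchimedeanLocalField.isLocalField F).toT2Space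
  haveI : SigmaCompactSpace F := sigmaCompactSpace_of_isNonarchimedeanLocalField F
  haveI : SigmaCompactSpace (Matrix ι ι F) := inferInstanceAs (SigmaCompactSpace (ι → ι → F))
  haveI : SigmaCompactSpace (Matrix ι ι F)ᵐᵒᵖ :=
    MulOpposite.opHomeomorph.symm.isClosedEmbedding.sigmaCompactSpace
  exact Units.isClosedEmbedding_embedProduct.sigmaCompactSpace

variable (F) in
/-- The standard Levi `Π_a GL_{n_a}(F)` of `GL_n(F)` (as the product group of `ParabolicGL`) is
`σ`-compact: a finite product of the `σ`-compact groups `GL_{n_a}(F)`. [folklore] -/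
theorem sigmaCompactSpace_levi {n : Type*} [Fintype n] [DecidableEq n] {α : Type*} [Fintype α]
    [DecidableEq α] (c : n → α) : SigmaCompactSpace (Π a, GL {i // c i = a} F) := by
  haveI : ∀ a, SigmaCompactSpace (GL {i // c i = a} F) :=
    fun a => sigmaCompactSpace_generalLinearGroup' F {i // c i = a}
  infer_instance

/-! ### The reduction of lang.S16 to the supercuspidal support -/

variable (F) in
/-- **Jacquet's admissibility theorem for `GL_n(F)` from the supercuspidal support**
(Bernstein–Zelevinsky 1976, Theorem 3.25, via 1977 Thm. 2.5): if every irreducible smooth complex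
representation of every `GL_n(F)` (on a space in the universe of `F`) embeds into some `i_c σ` with
`σ` an irreducible smooth supercuspidal representation of the standard Levi `Π_a GL_{n_a}(F)`
(the named fact `bernsteinZelevinsky_support F`, for all `n` and all spaces `V`), then every
irreducible smooth complex representation of `GL_n(F)` is admissible: `σ` is admissible
(`Representation.IsSupercuspidal.isAdmissible_of_sigmaCompactSpace` on the `σ`-compact Levi,
Harish-Chandra / Bernstein–Zelevinsky 1976, 3.21), `i_c σ` is admissible
(`Representation.isAdmissible_parabolicIndGL_holds`, 1976, 2.25 (c)), and `π ↪ i_c σ`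
(`Representation.IsAdmissible.of_injective`). [cite: BernsteinZelevinsky1976, Theorem 3.25] -/
theorem jacquetAdmissibility_gl_of_bernsteinZelevinsky_support
    (h : ∀ (n : ℕ) (V : Type u) [AddCommGroup V] [Module ℂ V],
      bernsteinZelevinsky_support F (n := n) (V := V)) :
    jacquetAdmissibility_gl F := by
  intro n V _ _ π hπ hirr
  obtain ⟨r, c, -, -, W, _, _, σ, hσirr, hσsm, hσsc, f, hf⟩ := h n V π hπ
  haveI : SigmaCompactSpace (Π a, GL {i // c i = a} F) := sigmaCompactSpace_levi F c
  have hσadm : σ.IsAdmissible := hσsc.isAdmissible_of_sigmaCompactSpace hσsm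
  have hind : (Representation.parabolicIndGL F c σ).IsAdmissible :=
    Representation.isAdmissible_parabolicIndGL_holds F c σ hσadm
  exact Representation.IsAdmissible.of_injective hπ f hf hind

end Literature.NumberTheory.Automorphic
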